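/-
Copyright (c) 2026 the pub-hodgecm-mathlib formalisation cell (harness21).  Prover seat hodgecm-mathlib-K2E3-p11 (g10), Track B «K2-LIT», #184♮ = hLiu418 =
`stmt-HodgeConjecture-24832`; socket #41, KIND W, (KW-arch-hBL) — KW desk F0P2-p08 (g4) 2026-09-05T01:25:09Z (B) «PEN := the GROWTH-FACE ADAPTER», architect
word #2 01:31Z (uniform constants = letter (L2) of K2Liu-p11 (g5)'s assembler (3c)).  THEOREMS ONLY (no `def`, no `instance`, no notation, no named-fact hypothesis, no `sorry`).
-/
import Summits.HodgeConjecture.HodgeConjecture.Theorems.K2LiuKindWArchWhittakerGrowthDispatch   -- ★ p864021 (this seat): `formula_of_abscissa_of_hol`; ★ p863827 `sign_trichotomy`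
import HarnessLib

/-!
# Crux `HLiu418`, socket #41, KIND W — `K2LiuKindWArchGrowthFaceOfRecord`: the per-place letter WITH THE (ii″) GROWTH FACE, constants UNIFORM over places and pictures

Cell `hodgecm-mathlib`, crux item hLiu418 = `stmt-HodgeConjecture-24832` (helper lane `--supports … --as helper`, count-neutral).  THE LETTER (L2) OF THE ASSEMBLER (3c)
`K2LiuKindWArchBlockLetterOfPlaceGrowth.hBL_of_placeGrowth` (K2Liu-p11 (g5), architect K2E3-p11): for every `z` with `0 < re z` ONE set of constants `(Cg, cg, N, N′, r)`, then for
every complex place `w`, picture index `i`, guarded `S` and `h` ONE continuation `Ew` of the twisted archimedean Whittaker integral at `(Q w i, Pt S h w, eb S h w)`,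
holomorphic on `{0 < re}`, with the `hW′` formula face on `{s₁ < re}` AND the (ii″) GROWTH FACE of ★ `K2LiuKindWArchWhittakerGrowth` (∀-form over the hermitian Iwasawa
letters `diag(C w, −B w)·Pt S h w = n(X₀)·diag(R,R⁻¹)·u₀`, `T₂` entrywise, blow-up `1 + ‖det‖^(−N′)` — KW desk ruling (KW-R5)) on `dist s z < r`.
INPUTS BY VALUE: the three BRANCH letters in the same uniform order per `(w, i)` — `hPosU` ∕ `hNegU` (payers: LH4-p08's 2b′ `exists_growth_constants_of_posDef∕negDef_at_one` ∘
(3d) K-uniformity (K2E4-p10), over ★ p864076 ∕ ★ p864118) and `hIndU` (the «Φ6b-ind» organ's (R3)+(R4), K2E4-p11) — plus the dispatch's frame ∕ index ∕ holomorphy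
letters (`hx hPt hherm hdet hWhol`); finiteness of `W` and of the picture index `ιQ`.
INSIDE: ★ `sign_trichotomy` per datum, ★ `formula_of_abscissa_of_hol` (abscissa move for the SAME `Ew`), and the MERGE of constants across the three branches and the
finitely many `(w, i)` — `Cg := 2·Σ`, `N, N′ := Σ`, `cg, r := (1 + Σ (·)⁻¹)⁻¹` — through the monotonicity of the face (`face_mono`; the `N′`-merge costs the factor `2`:
`1 + D^(−N′) ≤ 2·(1 + D^(−M′))` for `0 ≤ N′ ≤ M′`, `D ≥ 0`).
References: [Shimura1997] §16.4, §18.4; [KudlaRallis1994] §1; [MoeglinWaldspurger1995] IV.1.9.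
HONEST LABEL.  Count-neutral helper; `hBL` then rests on {(R3) «Φ6b-ind» growth, 2b′∘(3d) uniform definite growth, (3a) explicit chain, (3a′) carrier constant, (L3) height,
(3c) assembler}: `HC_CM` is proved only modulo the 7 printed citations (2 remaining named inputs: hLiu418 = `stmt-HodgeConjecture-24832`, h413 = `stmt-HodgeConjecture-24833`)
until rung 0 closes.
-/

set_option autoImplicit false
set_option linter.dupNamespace false -- the mandated namespace repeats `HodgeConjecture.HodgeConjecture`

noncomputable section

open Complex Matrix MeasureTheory
open scoped ComplexConjugate ComplexOrder

namespace Summit.HodgeConjecture.HodgeConjecture.Cruxes.HLiu418.K2LiuKindWArchGrowthFaceOfRecord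

open Literature.NumberTheory.ModularForms.SiegelUpperHalfSpace (moeb)
open Summit.HodgeConjecture.HodgeConjecture.Cruxes.HLiu418.K2LiuArchInducedTubeDefs
open Summit.HodgeConjecture.HodgeConjecture.Cruxes.HLiu418.K2LiuU22CompactPictureDefs
open Summit.HodgeConjecture.HodgeConjecture.Cruxes.HLiu418.K2LiuKindWArchWhittakerLetterDispatch (sign_trichotomy)
open Summit.HodgeConjecture.HodgeConjecture.Cruxes.HLiu418.K2LiuKindWArchWhittakerGrowthDispatch (formula_of_abscissa_of_hol)

/-! ## §1 Real bookkeeping: sums dominate terms, the common lower constant, the monotonicity of the face -/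

/-- a nonnegative term is bounded by the sum. [folklore] -/
theorem le_sum_univ {ι : Type*} [Fintype ι] {f : ι → ℝ} (hf : ∀ i, 0 ≤ f i) (a : ι) : f a ≤ ∑ i, f i :=
  Finset.single_le_sum (fun i _ => hf i) (Finset.mem_univ a)

/-- the common LOWER constant `(1 + Σ_q f q)⁻¹` lies below every `x > 0` with `x⁻¹ ≤ f p` (`f ≥ 0`). [folklore] -/
theorem inv_one_add_sum_le {ι : Type*} [Fintype ι] {f : ι → ℝ} (hf : ∀ q, 0 ≤ f q) {x : ℝ} (hx : 0 < x) (p : ι) (hxp : x⁻¹ ≤ f p) :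
    (1 + ∑ q, f q)⁻¹ ≤ x := by
  have h1 : x⁻¹ ≤ 1 + ∑ q, f q := (hxp.trans (le_sum_univ hf p)).trans (le_add_of_nonneg_left zero_le_one)
  calc (1 + ∑ q, f q)⁻¹ ≤ (x⁻¹)⁻¹ := inv_anti₀ (inv_pos.2 hx) h1
    _ = x := inv_inv _

/-- the `N′`-merge: `1 + D^(−N′) ≤ 2·(1 + D^(−M′))` for `D ≥ 0`, `0 ≤ N′ ≤ M′` (★ JUNCTION's device, here without `D > 0`). [folklore] -/
theorem one_add_rpow_neg_le_two_mul' {D N' M' : ℝ} (hD : 0 ≤ D) (hN' : 0 ≤ N') (hNM : N' ≤ M') : 1 + D ^ (-N') ≤ 2 * (1 + D ^ (-M')) := by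
  have hM : 0 ≤ D ^ (-M') := Real.rpow_nonneg hD _
  by_cases h1 : 1 ≤ D
  · have : D ^ (-N') ≤ 1 := Real.rpow_le_one_of_one_le_of_nonpos h1 (by linarith)
    linarith
  · rcases hD.eq_or_lt with h0 | hpos
    · rw [← h0]
      have : (0 : ℝ) ^ (-N') ≤ 1 := Real.zero_rpow_le_one _
      linarith [Real.zero_rpow_le_one (-M'), Real.rpow_nonneg (le_refl (0 : ℝ)) (-M')]
    · have : D ^ (-N') ≤ D ^ (-M') := Real.rpow_le_rpow_of_exponent_ge hpos (le_of_lt (not_le.1 h1)) (by linarith)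
      linarith

/-- **MONOTONICITY OF THE (ii″) FACE IN ITS CONSTANTS**: `Cg·A·e^(−cg T)·(1+T)^N·(1 + D^(−N′)) ≤ Cg′·A·e^(−cg′ T)·(1+T)^M·(1 + D^(−M′))` whenever `2Cg ≤ Cg′`, `cg′ ≤ cg`,
`N ≤ M`, `0 ≤ N′ ≤ M′` (`A, T, D ≥ 0`, `Cg ≥ 0`). [folklore] -/
theorem face_mono {Cg Cg' cg cg' N M N' M' A T D : ℝ} (hCg : 0 ≤ Cg) (hCC : 2 * Cg ≤ Cg') (hcc : cg' ≤ cg) (hNM : N ≤ M) (hN' : 0 ≤ N') (hNM' : N' ≤ M')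
    (hA : 0 ≤ A) (hT : 0 ≤ T) (hD : 0 ≤ D) :
    Cg * A * Real.exp (-(cg * T)) * (1 + T) ^ N * (1 + D ^ (-N')) ≤ Cg' * A * Real.exp (-(cg' * T)) * (1 + T) ^ M * (1 + D ^ (-M')) := by
  have h1 : Real.exp (-(cg * T)) ≤ Real.exp (-(cg' * T)) := Real.exp_le_exp.2 (by nlinarith)
  have h2 : (1 + T) ^ N ≤ (1 + T) ^ M := Real.rpow_le_rpow_of_exponent_le (by linarith) hNM
  have h3 : 1 + D ^ (-N') ≤ 2 * (1 + D ^ (-M')) := one_add_rpow_neg_le_two_mul' hD hN' hNM'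
  have hE' : 0 ≤ Real.exp (-(cg' * T)) := (Real.exp_pos _).le
  have hP : 0 ≤ (1 + T) ^ N := Real.rpow_nonneg (by linarith) _
  have hP' : 0 ≤ (1 + T) ^ M := Real.rpow_nonneg (by linarith) _
  have hQ : 0 ≤ 1 + D ^ (-N') := by linarith [Real.rpow_nonneg hD (-N')]
  have hQ' : 0 ≤ 1 + D ^ (-M') := by linarith [Real.rpow_nonneg hD (-M')]
  have h12 : Real.exp (-(cg * T)) * (1 + T) ^ N ≤ Real.exp (-(cg' * T)) * (1 + T) ^ M := mul_le_mul h1 h2 hP hE'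
  have h123 : Real.exp (-(cg * T)) * (1 + T) ^ N * (1 + D ^ (-N')) ≤ Real.exp (-(cg' * T)) * (1 + T) ^ M * (2 * (1 + D ^ (-M'))) :=
    mul_le_mul h12 h3 hQ (mul_nonneg hE' hP')
  have hCA : 0 ≤ Cg * A := mul_nonneg hCg hA
  calc Cg * A * Real.exp (-(cg * T)) * (1 + T) ^ N * (1 + D ^ (-N'))
      = (Cg * A) * (Real.exp (-(cg * T)) * (1 + T) ^ N * (1 + D ^ (-N'))) := by ring
    _ ≤ (Cg * A) * (Real.exp (-(cg' * T)) * (1 + T) ^ M * (2 * (1 + D ^ (-M')))) := mul_le_mul_of_nonneg_left h123 hCA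
    _ = (2 * Cg) * A * (Real.exp (-(cg' * T)) * (1 + T) ^ M * (1 + D ^ (-M'))) := by ring
    _ ≤ Cg' * A * (Real.exp (-(cg' * T)) * (1 + T) ^ M * (1 + D ^ (-M'))) :=
        mul_le_mul_of_nonneg_right (mul_le_mul_of_nonneg_right hCC hA) (mul_nonneg (mul_nonneg hE' hP') hQ')
    _ = Cg' * A * Real.exp (-(cg' * T)) * (1 + T) ^ M * (1 + D ^ (-M')) := by ring

/-! ## §2 HEAD — the uniform letter from the three uniform branch letters -/

/-- **THE PER-PLACE ARCHIMEDEAN WHITTAKER LETTER WITH THE (ii″) GROWTH FACE, UNIFORM CONSTANTS** (letter (L2) of the assembler (3c); see the module docstring).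
[cite: Shimura1997, §16.4, §18.4] [cite: KudlaRallis1994, §1] [cite: MoeglinWaldspurger1995, IV.1.9] -/
theorem hWgrU_of_record {ιS ιh W ιQ : Type*} [Fintype W] [Fintype ιQ] (good : ιS → Prop) (k : W → ℤ)
    (B C : W → Matrix (Fin 2) (Fin 2) ℂ)
    (hx : ∀ w, (fromBlocks 0 (B w) (C w) 0 : Matrix (Fin 2 ⊕ Fin 2) (Fin 2 ⊕ Fin 2) ℂ)ᴴ * Matrix.J (Fin 2) ℂ *
      (fromBlocks 0 (B w) (C w) 0 : Matrix (Fin 2 ⊕ Fin 2) (Fin 2 ⊕ Fin 2) ℂ) = Matrix.J (Fin 2) ℂ)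
    (Pt : ιS → ιh → W → Matrix (Fin 2 ⊕ Fin 2) (Fin 2 ⊕ Fin 2) ℂ) (hPt : ∀ S h w, (Pt S h w)ᴴ * Matrix.J (Fin 2) ℂ * Pt S h w = Matrix.J (Fin 2) ℂ)
    (eb : ιS → ιh → W → Matrix (Fin 2) (Fin 2) ℂ → ℂ) (hidx : ιS → ιh → W → Matrix (Fin 2) (Fin 2) ℂ)
    (hherm : ∀ S h w, (hidx S h w)ᴴ = hidx S h w) (hdet : ∀ S, good S → ∀ h w, (hidx S h w).det ≠ 0)
    (Q : W → ιQ → Carrier) (s₁ : ℝ) (hs₁ : 0 ≤ s₁)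
    (hWhol : ∀ (S : ιS), good S → ∀ (h : ιh) (w : W) (Q' : Carrier), ∀ s' : ℂ, s₁ < s'.re → ∀ F₀ : Matrix (Fin 2 ⊕ Fin 2) (Fin 2 ⊕ Fin 2) ℂ → ℂ,
      IsArchSiegelSection (fun z : ℂ => (conj z / ((‖z‖ : ℝ) : ℂ)) ^ (k w)) s' F₀ →
      (∀ (v : Matrix (Fin 2) (Fin 2) ℂ), vᴴ * v = 1 → ∀ hv : v.det ≠ 0,
        F₀ ((2 : ℂ)⁻¹ • fromBlocks (1 + v) (-(I • (1 - v))) (I • (1 - v)) (1 + v) : Matrix (Fin 2 ⊕ Fin 2) (Fin 2 ⊕ Fin 2) ℂ) = evalAt v hv Q') →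
      ∃ G : ℂ → Matrix (Fin 2 ⊕ Fin 2) (Fin 2 ⊕ Fin 2) ℂ → ℂ,
      (∀ s : ℂ, s₁ < s.re → IsArchSiegelSection (fun z : ℂ => (conj z / ((‖z‖ : ℝ) : ℂ)) ^ (k w)) s (G s)) ∧
      (∀ s : ℂ, s₁ < s.re → ∀ (v : Matrix (Fin 2) (Fin 2) ℂ), vᴴ * v = 1 → ∀ hv : v.det ≠ 0,
        G s ((2 : ℂ)⁻¹ • fromBlocks (1 + v) (-(I • (1 - v))) (I • (1 - v)) (1 + v) : Matrix (Fin 2 ⊕ Fin 2) (Fin 2 ⊕ Fin 2) ℂ) = evalAt v hv Q') ∧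
      DifferentiableOn ℂ (fun s : ℂ => ∫ r : Fin 2 → Fin 2 → ℝ,
        G s ((fromBlocks 0 (B w) (C w) 0 : Matrix (Fin 2 ⊕ Fin 2) (Fin 2 ⊕ Fin 2) ℂ) * fromBlocks 1 (hermOfReal r) 0 1 * Pt S h w) * eb S h w (hermOfReal r))
        {s : ℂ | s₁ < s.re})
    (hPosU : ∀ z : ℂ, 0 < z.re → ∀ (w : W) (i : ιQ), ∃ Cg cg N N' r : ℝ, 0 ≤ Cg ∧ 0 < cg ∧ 0 ≤ N ∧ 0 ≤ N' ∧ 0 < r ∧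
      ∀ (S : ιS), good S → ∀ (h : ιh), (hidx S h w).PosDef →
        ∃ (Ew : ℂ → ℂ) (s₀ : ℝ), DifferentiableOn ℂ Ew {s : ℂ | 0 < s.re} ∧
          (∀ s : ℂ, s₀ < s.re → ∀ F : Matrix (Fin 2 ⊕ Fin 2) (Fin 2 ⊕ Fin 2) ℂ → ℂ, IsArchSiegelSection (fun z : ℂ => (conj z / ((‖z‖ : ℝ) : ℂ)) ^ (k w)) s F →
            (∀ (v : Matrix (Fin 2) (Fin 2) ℂ), vᴴ * v = 1 → ∀ hv : v.det ≠ 0,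
              F ((2 : ℂ)⁻¹ • fromBlocks (1 + v) (-(I • (1 - v))) (I • (1 - v)) (1 + v) : Matrix (Fin 2 ⊕ Fin 2) (Fin 2 ⊕ Fin 2) ℂ) = evalAt v hv (Q w i)) →
            ∫ x : Fin 2 → Fin 2 → ℝ, F ((fromBlocks 0 (B w) (C w) 0 : Matrix (Fin 2 ⊕ Fin 2) (Fin 2 ⊕ Fin 2) ℂ) * fromBlocks 1 (hermOfReal x) 0 1 * Pt S h w) *
              eb S h w (hermOfReal x) = Ew s) ∧
          ∀ s : ℂ, dist s z < r →
            ∀ (X₀ R : Matrix (Fin 2) (Fin 2) ℂ) (u₀ : Matrix (Fin 2 ⊕ Fin 2) (Fin 2 ⊕ Fin 2) ℂ), X₀ᴴ = X₀ → Rᴴ = R → IsUnit R.det →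
              u₀ᴴ * Matrix.J (Fin 2) ℂ * u₀ = Matrix.J (Fin 2) ℂ → moeb u₀ (I • (1 : Matrix (Fin 2) (Fin 2) ℂ)) = I • 1 →
              (fromBlocks (C w) 0 0 (-(B w)) : Matrix (Fin 2 ⊕ Fin 2) (Fin 2 ⊕ Fin 2) ℂ) * Pt S h w = fromBlocks 1 X₀ 0 1 * fromBlocks R 0 0 R⁻¹ * u₀ →
              ‖Ew s‖ ≤ Cg * ‖R.det‖ ^ (2 - 2 * s.re) * Real.exp (-(cg * ∑ a, ∑ b, ‖(R * (((C w)⁻¹)ᴴ * hidx S h w * (C w)⁻¹) * R) a b‖)) *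
                (1 + ∑ a, ∑ b, ‖(R * (((C w)⁻¹)ᴴ * hidx S h w * (C w)⁻¹) * R) a b‖) ^ N * (1 + ‖(R * (((C w)⁻¹)ᴴ * hidx S h w * (C w)⁻¹) * R).det‖ ^ (-N')))
    (hNegU : ∀ z : ℂ, 0 < z.re → ∀ (w : W) (i : ιQ), ∃ Cg cg N N' r : ℝ, 0 ≤ Cg ∧ 0 < cg ∧ 0 ≤ N ∧ 0 ≤ N' ∧ 0 < r ∧
      ∀ (S : ιS), good S → ∀ (h : ιh), (-hidx S h w).PosDef →
        ∃ (Ew : ℂ → ℂ) (s₀ : ℝ), DifferentiableOn ℂ Ew {s : ℂ | 0 < s.re} ∧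
          (∀ s : ℂ, s₀ < s.re → ∀ F : Matrix (Fin 2 ⊕ Fin 2) (Fin 2 ⊕ Fin 2) ℂ → ℂ, IsArchSiegelSection (fun z : ℂ => (conj z / ((‖z‖ : ℝ) : ℂ)) ^ (k w)) s F →
            (∀ (v : Matrix (Fin 2) (Fin 2) ℂ), vᴴ * v = 1 → ∀ hv : v.det ≠ 0,
              F ((2 : ℂ)⁻¹ • fromBlocks (1 + v) (-(I • (1 - v))) (I • (1 - v)) (1 + v) : Matrix (Fin 2 ⊕ Fin 2) (Fin 2 ⊕ Fin 2) ℂ) = evalAt v hv (Q w i)) →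
            ∫ x : Fin 2 → Fin 2 → ℝ, F ((fromBlocks 0 (B w) (C w) 0 : Matrix (Fin 2 ⊕ Fin 2) (Fin 2 ⊕ Fin 2) ℂ) * fromBlocks 1 (hermOfReal x) 0 1 * Pt S h w) *
              eb S h w (hermOfReal x) = Ew s) ∧
          ∀ s : ℂ, dist s z < r →
            ∀ (X₀ R : Matrix (Fin 2) (Fin 2) ℂ) (u₀ : Matrix (Fin 2 ⊕ Fin 2) (Fin 2 ⊕ Fin 2) ℂ), X₀ᴴ = X₀ → Rᴴ = R → IsUnit R.det →
              u₀ᴴ * Matrix.J (Fin 2) ℂ * u₀ = Matrix.J (Fin 2) ℂ → moeb u₀ (I • (1 : Matrix (Fin 2) (Fin 2) ℂ)) = I • 1 →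
              (fromBlocks (C w) 0 0 (-(B w)) : Matrix (Fin 2 ⊕ Fin 2) (Fin 2 ⊕ Fin 2) ℂ) * Pt S h w = fromBlocks 1 X₀ 0 1 * fromBlocks R 0 0 R⁻¹ * u₀ →
              ‖Ew s‖ ≤ Cg * ‖R.det‖ ^ (2 - 2 * s.re) * Real.exp (-(cg * ∑ a, ∑ b, ‖(R * (((C w)⁻¹)ᴴ * hidx S h w * (C w)⁻¹) * R) a b‖)) *
                (1 + ∑ a, ∑ b, ‖(R * (((C w)⁻¹)ᴴ * hidx S h w * (C w)⁻¹) * R) a b‖) ^ N * (1 + ‖(R * (((C w)⁻¹)ᴴ * hidx S h w * (C w)⁻¹) * R).det‖ ^ (-N')))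
    (hIndU : ∀ z : ℂ, 0 < z.re → ∀ (w : W) (i : ιQ), ∃ Cg cg N N' r : ℝ, 0 ≤ Cg ∧ 0 < cg ∧ 0 ≤ N ∧ 0 ≤ N' ∧ 0 < r ∧
      ∀ (S : ιS), good S → ∀ (h : ιh), (hidx S h w).det.re < 0 →
        ∃ (Ew : ℂ → ℂ) (s₀ : ℝ), DifferentiableOn ℂ Ew {s : ℂ | 0 < s.re} ∧
          (∀ s : ℂ, s₀ < s.re → ∀ F : Matrix (Fin 2 ⊕ Fin 2) (Fin 2 ⊕ Fin 2) ℂ → ℂ, IsArchSiegelSection (fun z : ℂ => (conj z / ((‖z‖ : ℝ) : ℂ)) ^ (k w)) s F →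
            (∀ (v : Matrix (Fin 2) (Fin 2) ℂ), vᴴ * v = 1 → ∀ hv : v.det ≠ 0,
              F ((2 : ℂ)⁻¹ • fromBlocks (1 + v) (-(I • (1 - v))) (I • (1 - v)) (1 + v) : Matrix (Fin 2 ⊕ Fin 2) (Fin 2 ⊕ Fin 2) ℂ) = evalAt v hv (Q w i)) →
            ∫ x : Fin 2 → Fin 2 → ℝ, F ((fromBlocks 0 (B w) (C w) 0 : Matrix (Fin 2 ⊕ Fin 2) (Fin 2 ⊕ Fin 2) ℂ) * fromBlocks 1 (hermOfReal x) 0 1 * Pt S h w) *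
              eb S h w (hermOfReal x) = Ew s) ∧
          ∀ s : ℂ, dist s z < r →
            ∀ (X₀ R : Matrix (Fin 2) (Fin 2) ℂ) (u₀ : Matrix (Fin 2 ⊕ Fin 2) (Fin 2 ⊕ Fin 2) ℂ), X₀ᴴ = X₀ → Rᴴ = R → IsUnit R.det →
              u₀ᴴ * Matrix.J (Fin 2) ℂ * u₀ = Matrix.J (Fin 2) ℂ → moeb u₀ (I • (1 : Matrix (Fin 2) (Fin 2) ℂ)) = I • 1 →
              (fromBlocks (C w) 0 0 (-(B w)) : Matrix (Fin 2 ⊕ Fin 2) (Fin 2 ⊕ Fin 2) ℂ) * Pt S h w = fromBlocks 1 X₀ 0 1 * fromBlocks R 0 0 R⁻¹ * u₀ →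
              ‖Ew s‖ ≤ Cg * ‖R.det‖ ^ (2 - 2 * s.re) * Real.exp (-(cg * ∑ a, ∑ b, ‖(R * (((C w)⁻¹)ᴴ * hidx S h w * (C w)⁻¹) * R) a b‖)) *
                (1 + ∑ a, ∑ b, ‖(R * (((C w)⁻¹)ᴴ * hidx S h w * (C w)⁻¹) * R) a b‖) ^ N * (1 + ‖(R * (((C w)⁻¹)ᴴ * hidx S h w * (C w)⁻¹) * R).det‖ ^ (-N')))
    :
    ∀ z : ℂ, 0 < z.re → ∃ Cg cg N N' r : ℝ, 0 ≤ Cg ∧ 0 < cg ∧ 0 ≤ N ∧ 0 ≤ N' ∧ 0 < r ∧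
      ∀ (w : W) (i : ιQ) (S : ιS), good S → ∀ (h : ιh),
        ∃ Ew : ℂ → ℂ, DifferentiableOn ℂ Ew {s : ℂ | 0 < s.re} ∧
          (∀ s : ℂ, s₁ < s.re → ∀ F : Matrix (Fin 2 ⊕ Fin 2) (Fin 2 ⊕ Fin 2) ℂ → ℂ, IsArchSiegelSection (fun z : ℂ => (conj z / ((‖z‖ : ℝ) : ℂ)) ^ (k w)) s F →
            (∀ (v : Matrix (Fin 2) (Fin 2) ℂ), vᴴ * v = 1 → ∀ hv : v.det ≠ 0,
              F ((2 : ℂ)⁻¹ • fromBlocks (1 + v) (-(I • (1 - v))) (I • (1 - v)) (1 + v) : Matrix (Fin 2 ⊕ Fin 2) (Fin 2 ⊕ Fin 2) ℂ) = evalAt v hv (Q w i)) →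
            ∫ x : Fin 2 → Fin 2 → ℝ, F ((fromBlocks 0 (B w) (C w) 0 : Matrix (Fin 2 ⊕ Fin 2) (Fin 2 ⊕ Fin 2) ℂ) * fromBlocks 1 (hermOfReal x) 0 1 * Pt S h w) *
              eb S h w (hermOfReal x) = Ew s) ∧
          ∀ s : ℂ, dist s z < r →
            ∀ (X₀ R : Matrix (Fin 2) (Fin 2) ℂ) (u₀ : Matrix (Fin 2 ⊕ Fin 2) (Fin 2 ⊕ Fin 2) ℂ), X₀ᴴ = X₀ → Rᴴ = R → IsUnit R.det →
              u₀ᴴ * Matrix.J (Fin 2) ℂ * u₀ = Matrix.J (Fin 2) ℂ → moeb u₀ (I • (1 : Matrix (Fin 2) (Fin 2) ℂ)) = I • 1 →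
              (fromBlocks (C w) 0 0 (-(B w)) : Matrix (Fin 2 ⊕ Fin 2) (Fin 2 ⊕ Fin 2) ℂ) * Pt S h w = fromBlocks 1 X₀ 0 1 * fromBlocks R 0 0 R⁻¹ * u₀ →
              ‖Ew s‖ ≤ Cg * ‖R.det‖ ^ (2 - 2 * s.re) * Real.exp (-(cg * ∑ a, ∑ b, ‖(R * (((C w)⁻¹)ᴴ * hidx S h w * (C w)⁻¹) * R) a b‖)) *
                (1 + ∑ a, ∑ b, ‖(R * (((C w)⁻¹)ᴴ * hidx S h w * (C w)⁻¹) * R) a b‖) ^ N * (1 + ‖(R * (((C w)⁻¹)ᴴ * hidx S h w * (C w)⁻¹) * R).det‖ ^ (-N')) := by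
  intro z hz
  -- the branch constants, chosen once per `(w, i)`
  choose Cg₁ cg₁ N₁ N'₁ r₁ hCg₁ hcg₁ hN₁ hN'₁ hr₁ hP₁ using hPosU z hz
  choose Cg₂ cg₂ N₂ N'₂ r₂ hCg₂ hcg₂ hN₂ hN'₂ hr₂ hP₂ using hNegU z hz
  choose Cg₃ cg₃ N₃ N'₃ r₃ hCg₃ hcg₃ hN₃ hN'₃ hr₃ hP₃ using hIndU z hz
  -- the merged constants (sums dominate terms; `(1 + Σ (·)⁻¹)⁻¹` is a positive common lower bound)
  set fC : W × ιQ → ℝ := fun p => Cg₁ p.1 p.2 + Cg₂ p.1 p.2 + Cg₃ p.1 p.2 with hfC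
  set fN : W × ιQ → ℝ := fun p => N₁ p.1 p.2 + N₂ p.1 p.2 + N₃ p.1 p.2 with hfN
  set fN' : W × ιQ → ℝ := fun p => N'₁ p.1 p.2 + N'₂ p.1 p.2 + N'₃ p.1 p.2 with hfN'
  set fc : W × ιQ → ℝ := fun p => (cg₁ p.1 p.2)⁻¹ + (cg₂ p.1 p.2)⁻¹ + (cg₃ p.1 p.2)⁻¹ with hfc
  set fr : W × ιQ → ℝ := fun p => (r₁ p.1 p.2)⁻¹ + (r₂ p.1 p.2)⁻¹ + (r₃ p.1 p.2)⁻¹ with hfr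
  have hfC0 : ∀ p, 0 ≤ fC p := fun p => by simp only [hfC]; linarith [hCg₁ p.1 p.2, hCg₂ p.1 p.2, hCg₃ p.1 p.2]
  have hfN0 : ∀ p, 0 ≤ fN p := fun p => by simp only [hfN]; linarith [hN₁ p.1 p.2, hN₂ p.1 p.2, hN₃ p.1 p.2]
  have hfN'0 : ∀ p, 0 ≤ fN' p := fun p => by simp only [hfN']; linarith [hN'₁ p.1 p.2, hN'₂ p.1 p.2, hN'₃ p.1 p.2]
  have hfc0 : ∀ p, 0 ≤ fc p := fun p => by
    have h₁ := inv_pos.2 (hcg₁ p.1 p.2); have h₂ := inv_pos.2 (hcg₂ p.1 p.2); have h₃ := inv_pos.2 (hcg₃ p.1 p.2)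
    simp only [hfc]; linarith
  have hfr0 : ∀ p, 0 ≤ fr p := fun p => by
    have h₁ := inv_pos.2 (hr₁ p.1 p.2); have h₂ := inv_pos.2 (hr₂ p.1 p.2); have h₃ := inv_pos.2 (hr₃ p.1 p.2)
    simp only [hfr]; linarith
  have hcU0 : 0 < (1 + ∑ p, fc p)⁻¹ := inv_pos.2 (add_pos_of_pos_of_nonneg one_pos (Finset.sum_nonneg fun p _ => hfc0 p))
  have hrU0 : 0 < (1 + ∑ p, fr p)⁻¹ := inv_pos.2 (add_pos_of_pos_of_nonneg one_pos (Finset.sum_nonneg fun p _ => hfr0 p))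
  refine ⟨2 * ∑ p, fC p, (1 + ∑ p, fc p)⁻¹, ∑ p, fN p, ∑ p, fN' p, (1 + ∑ p, fr p)⁻¹,
    by linarith [Finset.sum_nonneg fun p (_ : p ∈ Finset.univ) => hfC0 p], hcU0, Finset.sum_nonneg fun p _ => hfN0 p,
    Finset.sum_nonneg fun p _ => hfN'0 p, hrU0, ?_⟩
  intro w i S hS h
  -- the per-`(w,i)` comparisons with the merged constants
  have hCw : fC (w, i) ≤ ∑ p, fC p := le_sum_univ hfC0 (w, i)
  have hNw : fN (w, i) ≤ ∑ p, fN p := le_sum_univ hfN0 (w, i)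
  have hN'w : fN' (w, i) ≤ ∑ p, fN' p := le_sum_univ hfN'0 (w, i)
  simp only [hfC] at hCw
  simp only [hfN] at hNw
  simp only [hfN'] at hN'w
  have hic₁ := inv_pos.2 (hcg₁ w i); have hic₂ := inv_pos.2 (hcg₂ w i); have hic₃ := inv_pos.2 (hcg₃ w i)
  have hir₁ := inv_pos.2 (hr₁ w i); have hir₂ := inv_pos.2 (hr₂ w i); have hir₃ := inv_pos.2 (hr₃ w i)
  have hc₁ : (1 + ∑ p, fc p)⁻¹ ≤ cg₁ w i := inv_one_add_sum_le hfc0 (hcg₁ w i) (w, i) (by simp only [hfc]; linarith)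
  have hc₂ : (1 + ∑ p, fc p)⁻¹ ≤ cg₂ w i := inv_one_add_sum_le hfc0 (hcg₂ w i) (w, i) (by simp only [hfc]; linarith)
  have hc₃ : (1 + ∑ p, fc p)⁻¹ ≤ cg₃ w i := inv_one_add_sum_le hfc0 (hcg₃ w i) (w, i) (by simp only [hfc]; linarith)
  have hρ₁ : (1 + ∑ p, fr p)⁻¹ ≤ r₁ w i := inv_one_add_sum_le hfr0 (hr₁ w i) (w, i) (by simp only [hfr]; linarith)
  have hρ₂ : (1 + ∑ p, fr p)⁻¹ ≤ r₂ w i := inv_one_add_sum_le hfr0 (hr₂ w i) (w, i) (by simp only [hfr]; linarith)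
  have hρ₃ : (1 + ∑ p, fr p)⁻¹ ≤ r₃ w i := inv_one_add_sum_le hfr0 (hr₃ w i) (w, i) (by simp only [hfr]; linarith)
  have hT0 : ∀ (R : Matrix (Fin 2) (Fin 2) ℂ), 0 ≤ ∑ a, ∑ b, ‖(R * (((C w)⁻¹)ᴴ * hidx S h w * (C w)⁻¹) * R) a b‖ :=
    fun R => Finset.sum_nonneg fun a _ => Finset.sum_nonneg fun b _ => norm_nonneg _
  -- per datum: the branch by the sign of the index, its continuation `Ew`, the abscissa move, the merged face
  rcases sign_trichotomy (hherm S h w) (hdet S hS h w) with hpos | hneg | hind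
  · obtain ⟨Ew, s₀, hEw, hform, hbnd⟩ := hP₁ w i S hS h hpos
    refine ⟨Ew, hEw, formula_of_abscissa_of_hol (hx w) (hPt S h w) hs₁ (hWhol S hS h w (Q w i)) hEw hform, ?_⟩
    intro s hs X₀ R u₀ hX₀ hR hRu hu₀ hu₀I hdec
    exact (hbnd s (lt_of_lt_of_le hs hρ₁) X₀ R u₀ hX₀ hR hRu hu₀ hu₀I hdec).trans
      (face_mono (hCg₁ w i) (by linarith [hCg₂ w i, hCg₃ w i]) hc₁ (by linarith [hN₂ w i, hN₃ w i]) (hN'₁ w i) (by linarith [hN'₂ w i, hN'₃ w i])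
        (Real.rpow_nonneg (norm_nonneg _) _) (hT0 R) (norm_nonneg _))
  · obtain ⟨Ew, s₀, hEw, hform, hbnd⟩ := hP₂ w i S hS h hneg
    refine ⟨Ew, hEw, formula_of_abscissa_of_hol (hx w) (hPt S h w) hs₁ (hWhol S hS h w (Q w i)) hEw hform, ?_⟩
    intro s hs X₀ R u₀ hX₀ hR hRu hu₀ hu₀I hdec
    exact (hbnd s (lt_of_lt_of_le hs hρ₂) X₀ R u₀ hX₀ hR hRu hu₀ hu₀I hdec).trans
      (face_mono (hCg₂ w i) (by linarith [hCg₁ w i, hCg₃ w i]) hc₂ (by linarith [hN₁ w i, hN₃ w i]) (hN'₂ w i) (by linarith [hN'₁ w i, hN'₃ w i])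
        (Real.rpow_nonneg (norm_nonneg _) _) (hT0 R) (norm_nonneg _))
  · obtain ⟨Ew, s₀, hEw, hform, hbnd⟩ := hP₃ w i S hS h hind
    refine ⟨Ew, hEw, formula_of_abscissa_of_hol (hx w) (hPt S h w) hs₁ (hWhol S hS h w (Q w i)) hEw hform, ?_⟩
    intro s hs X₀ R u₀ hX₀ hR hRu hu₀ hu₀I hdec
    exact (hbnd s (lt_of_lt_of_le hs hρ₃) X₀ R u₀ hX₀ hR hRu hu₀ hu₀I hdec).trans
      (face_mono (hCg₃ w i) (by linarith [hCg₁ w i, hCg₂ w i]) hc₃ (by linarith [hN₁ w i, hN₂ w i]) (hN'₃ w i) (by linarith [hN'₁ w i, hN'₂ w i])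
        (Real.rpow_nonneg (norm_nonneg _) _) (hT0 R) (norm_nonneg _))

end Summit.HodgeConjecture.HodgeConjecture.Cruxes.HLiu418.K2LiuKindWArchGrowthFaceOfRecord

end
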